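import Literature.NumberTheory.Automorphic.ClozelCArithmetic
import Literature.NumberTheory.Automorphic.ClozelAlgebraicityRatFieldProofs
import Literature.NumberTheory.Automorphic.ClozelAlgebraicityGLOneProofs
import Literature.NumberTheory.Automorphic.ReciprocityGLnRankOneProofs
import Literature.NumberTheory.Automorphic.AutomorphicInductionUnitaryCharacterCubicGaloisProofs
import Literature.NumberTheory.GaloisRepresentations.HeckeCharacterValueFieldProofs
import HarnessLib

/-!
# Clozel's C-arithmeticity theorem (Thm. 3.13) in rank one, proved: the Hecke eigenvalues of a
# regular algebraic automorphic representation of `GL₁(𝔸_K)` lie in a number field (Weil)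

Topic `Literature/NumberTheory/Automorphic`; namespace `Literature.NumberTheory.Automorphic`.
PROOFS file (theorems only: no definition, no named fact, no instance) for the named facts
`Clozel1990_cArithmetic` (`ClozelCArithmetic.lean`) and `Clozel1990_heckeEigenvalueField`
(`ClozelAlgebraicity.lean`) — the two (definitionally equal) vendorings of Clozel 1990, Thm. 3.13
in Hecke-eigenvalue form — in the case `n = 1`, for EVERY number field `K`.

**The result.** L. Clozel, *Motifs et formes automorphes* (1990), Thm. 3.13 for `n = 1` is, by
Clozel's §1 dictionary "algebraic automorphic representations of `GL(1)` = Hecke characters of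
type `A₀`", A. Weil's theorem (*On a certain type of characters of the idèle-class group of an
algebraic number-field*, Tokyo–Nikko 1955, §1; Patrikis 2019, Lemma 2.1.2): the values `χ(ϖ_v)`
of an algebraic Hecke character at the unramified places lie in one number field. Both halves are
theorems of the tree; this file assembles them on the Borel–Jacquet carriers of the facts:

* `CuspidalAutomorphicRepData.exists_numberField_heckeEigenvalueOf_mem_rank_one` — for `π`
  cuspidal regular algebraic on `GL₁(𝔸_K)` there is a subfield `E ⊆ ℂ`, finite over `ℚ` and
  containing every conjugate of `K`, such that at EVERY finite place `v` where `π` has a Satake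
  parameter `α`, and every `i ≤ 1`, `heckeEigenvalueOf 1 v α i ∈ E` (`t_{v,0} = 1`,
  `t_{v,1} = χ_π(ϖ_v)`). Proof: `π` has a Hecke character `χ_π`
  (`AutomorphicRepData.exists_heckeCharacter_glOne`), algebraic because `π` is C-algebraic
  (`…isAlgebraic_heckeCharacter_glOne_of_isCAlgebraic`), unramified wherever `π` is
  (`…isUnramifiedAt_heckeCharacter_glOne`); the Satake parameter at `v` is `{χ_π(⟨ϖ⟩_v)}` for the
  witnessing uniformizer (`…exists_eq_singleton_of_hasSatakeParamAt_glOne`), which is `χ_π(ϖ_v)`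
  for the chosen one (`HeckeCharacter.localComponent_eq_valueAtUniformizer`), and Weil's theorem
  (`HeckeCharacter.IsAlgebraic.exists_intermediateField_valueAtUniformizer_mem`) gives the field.
* `Clozel1990_cArithmetic.rank_one`, `Clozel1990_heckeEigenvalueField.rank_one` — the `n = 1`
  slices of the two named facts VERBATIM (cofinite form), hence also the `n = 1` slice of the
  route input item `Summit.Langlands.Langlands.Theses.IrreducibilityBySelfDuality.HeckeEigenvalueField`
  (stmt-Langlands-13632), which is the same text.
* `CuspidalAutomorphicRepData.finiteDimensional_ratField_rank_one` — consequently clause (i) of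
  `Clozel1990_regularAlgebraic` for `n = 1`: the rationality field `ℚ(π_f) = ratField π` of a
  cuspidal regular algebraic `π` on `GL₁(𝔸_K)` is finite over `ℚ`
  (`finiteDimensional_ratField_of_heckeEigenvalue_mem` of `ClozelAlgebraicityRatFieldProofs`).
* `AutomorphicRepData.isAutConjugate_glOne_autConj_of_heckeCharacter`,
  `CuspidalAutomorphicRepData.exists_cuspidal_isAutConjugate_rank_one` — clause (ii) of Thm. 3.13
  for `n = 1`, FINITE PART: every cuspidal regular algebraic `π` on `GL₁(𝔸_K)` has a cuspidal
  `σ`-conjugate at almost all places for every `σ ∈ Aut(ℂ)`, namely `π_{^σχ_π}`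
  (`isAutConjugate_glOne_autConj` of `ClozelAlgebraicityGLOneProofs` relaxed from `π = ℂ·(χ∘det)/⊥`
  to an arbitrary datum with Hecke character `χ`; the archimedean half of (ii) is not asserted).

Not here: any `n ≥ 2` (Clozel's cohomological argument, §3.5 — not in the tree); the archimedean
half of (ii), purity (iii) and the CM property (iv) for `n = 1`.

## References

* L. Clozel, *Motifs et formes automorphes: applications du principe de fonctorialité*, in
  Automorphic forms, Shimura varieties, and L-functions I (1990), §1, Thm. 3.13. [Clozel1990]
* A. Weil, *On a certain type of characters of the idèle-class group of an algebraic
  number-field*, Proc. Int. Symp. Tokyo–Nikko 1955 (1956), 1–7, §1. [Weil1956]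
* S. Patrikis, *Variations on a theorem of Tate*, Mem. AMS 258 (2019) = arXiv:1207.6724,
  Lemma 2.1.2 and Thm. 3.2.1. [Patrikis2019]
-/

open scoped Classical NumberField
open NumberField IsDedekindDomain Filter

namespace Literature.NumberTheory.Automorphic

open Literature.NumberTheory.GaloisRepresentations

variable {K : Type} [Field K] [NumberField K]

/-- The `0`-th Hecke eigenvalue of a singleton Satake parameter in rank one is `1`
(`t_{v,0} = q_v^0 e_0 = 1`). [folklore] -/
theorem heckeEigenvalueOf_one_singleton_zero (v : HeightOneSpectrum (𝓞 K)) (c : ℂ) :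
    heckeEigenvalueOf 1 v {c} 0 = 1 := by
  simp [heckeEigenvalueOf, Multiset.esymm]

/-- The `1`-st Hecke eigenvalue of a singleton Satake parameter `{c}` in rank one is `c`
(`t_{v,1} = q_v^{1·0/2} e_1({c}) = c`). [folklore] -/
theorem heckeEigenvalueOf_one_singleton_one (v : HeightOneSpectrum (𝓞 K)) (c : ℂ) :
    heckeEigenvalueOf 1 v {c} 1 = c := by
  simp [heckeEigenvalueOf, Multiset.esymm, Multiset.powersetCard_one]

/-- **Clozel's Thm. 3.13 for `GL₁`, pointwise form (Weil).** For a cuspidal regular algebraic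
automorphic representation `π` of `GL₁(𝔸_K)` (`K` any number field) there is a subfield `E ⊆ ℂ`,
finite over `ℚ` and containing every conjugate of `K`, such that at EVERY finite place `v` at which
`π` has a Satake parameter `α` (i.e. is unramified), every Hecke eigenvalue
`heckeEigenvalueOf 1 v α i`, `i ≤ 1`, lies in `E`: `t_{v,0} = 1` and `t_{v,1} = χ_π(ϖ_v)`, the
value at a uniformizer of the (algebraic, there unramified) Hecke character of `π`, which lies in
Weil's number field. Clozel 1990, §1 and Thm. 3.13 (`n = 1`); Weil 1956, §1.
[cite: Clozel1990, Thm. 3.13 (n = 1)] [cite: Weil1956, §1] -/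
theorem CuspidalAutomorphicRepData.exists_numberField_heckeEigenvalueOf_mem_rank_one
    {hcpt : isCompact_glFiniteIntegralLevel 1 K} (π : CuspidalAutomorphicRepData 1 K hcpt)
    (hπ : π.1.IsRegularAlgebraic) :
    ∃ E : Subfield ℂ, FiniteDimensional ℚ E ∧ (∀ (φ : K →+* ℂ) (x : K), φ x ∈ E) ∧
      ∀ (v : HeightOneSpectrum (𝓞 K)) (α : Multiset ℂ), π.1.HasSatakeParamAt v α →
        ∀ i ≤ 1, heckeEigenvalueOf 1 v α i ∈ E := by
  obtain ⟨χ, hχ⟩ := π.1.exists_heckeCharacter_glOne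
  have halg : χ.IsAlgebraic :=
    π.1.isAlgebraic_heckeCharacter_glOne_of_isCAlgebraic hχ hπ.isCAlgebraic
  obtain ⟨E, hfd, hemb, hval⟩ := halg.exists_intermediateField_valueAtUniformizer_mem
  refine ⟨E.toSubfield, hfd, hemb, fun v α hα i hi ↦ ?_⟩
  have hur : χ.IsUnramifiedAt v := π.1.isUnramifiedAt_heckeCharacter_glOne hχ hα
  obtain ⟨ϖ, hϖ, rfl⟩ := π.1.exists_eq_singleton_of_hasSatakeParamAt_glOne hχ hα
  have hc : ((χ (localUnits v ϖ) : ℂˣ) : ℂ) = χ.valueAtUniformizer v := by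
    rw [← HeckeCharacter.localComponent_eq_valueAtUniformizer hur hϖ,
      HeckeCharacter.localComponent_apply]
  rcases Nat.le_one_iff_eq_zero_or_eq_one.1 hi with rfl | rfl
  · rw [heckeEigenvalueOf_one_singleton_zero]
    exact one_mem _
  · rw [heckeEigenvalueOf_one_singleton_one, hc]
    exact hval v hur

/-- **`Clozel1990_cArithmetic` for `n = 1`, proved** (its `n = 1` slice verbatim): for `π`
cuspidal regular algebraic on `GL₁(𝔸_K)`, `K` any number field, one number field `E ⊆ ℂ` contains
the Hecke eigenvalues `heckeEigenvalueOf 1 v α i` (`i ≤ 1`, `α` a Satake parameter of `π` at `v`)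
at all but finitely many `v` — indeed at all `v` where `π` is unramified
(`exists_numberField_heckeEigenvalueOf_mem_rank_one`). Clozel 1990, Thm. 3.13 (`n = 1`) =
Weil 1956. [cite: Clozel1990, Thm. 3.13 (n = 1)] [cite: Weil1956, §1] -/
theorem Clozel1990_cArithmetic.rank_one (K : Type) [Field K] [NumberField K]
    (hcpt : isCompact_glFiniteIntegralLevel 1 K) (π : CuspidalAutomorphicRepData 1 K hcpt)
    (hπ : π.1.IsRegularAlgebraic) :
    ∃ E : Subfield ℂ, FiniteDimensional ℚ E ∧
      ∀ᶠ v : HeightOneSpectrum (𝓞 K) in Filter.cofinite, ∀ α : Multiset ℂ,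
        π.1.HasSatakeParamAt v α → ∀ i ≤ 1, heckeEigenvalueOf 1 v α i ∈ E := by
  obtain ⟨E, hfd, -, h⟩ := π.exists_numberField_heckeEigenvalueOf_mem_rank_one hπ
  exact ⟨E, hfd, Filter.Eventually.of_forall h⟩

/-- **`Clozel1990_heckeEigenvalueField` for `n = 1`, proved** (its `n = 1` slice verbatim; the
same proposition as `Clozel1990_cArithmetic.rank_one`). This is also, verbatim up to unfolding
`heckeEigenvalueOf`, the `n = 1` slice of the route input item
`IrreducibilityBySelfDuality.HeckeEigenvalueField` (stmt-Langlands-13632).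
Clozel 1990, Thm. 3.13 (`n = 1`) = Weil 1956. [cite: Clozel1990, Thm. 3.13 (n = 1)] -/
theorem Clozel1990_heckeEigenvalueField.rank_one (K : Type) [Field K] [NumberField K]
    (hcpt : isCompact_glFiniteIntegralLevel 1 K) (π : CuspidalAutomorphicRepData 1 K hcpt)
    (hπ : π.1.IsRegularAlgebraic) :
    ∃ E : Subfield ℂ, FiniteDimensional ℚ E ∧
      ∀ᶠ v : HeightOneSpectrum (𝓞 K) in Filter.cofinite, ∀ α : Multiset ℂ,
        π.1.HasSatakeParamAt v α → ∀ i ≤ 1, heckeEigenvalueOf 1 v α i ∈ E :=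
  Clozel1990_cArithmetic.rank_one K hcpt π hπ

/-- **Clause (i) of Clozel's Thm. 3.13 for `GL₁`, proved: `ℚ(π_f)` is a number field.** For a
cuspidal regular algebraic `π` on `GL₁(𝔸_K)` the rationality field `ratField π.1` (the fixed
field of the Hecke stabiliser, `ClozelAlgebraicity`) is finite over `ℚ`: the unramified Hecke
eigenvalues lie in Weil's number field (`Clozel1990_cArithmetic.rank_one`), and
`finiteDimensional_ratField_of_heckeEigenvalue_mem` (`ClozelAlgebraicityRatFieldProofs`).
Clozel 1990, Thm. 3.13 (i) for `n = 1`; Weil 1956. [cite: Clozel1990, Thm. 3.13 (i) (n = 1)] -/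
theorem CuspidalAutomorphicRepData.finiteDimensional_ratField_rank_one
    {hcpt : isCompact_glFiniteIntegralLevel 1 K} (π : CuspidalAutomorphicRepData 1 K hcpt)
    (hπ : π.1.IsRegularAlgebraic) : FiniteDimensional ℚ (ratField π.1) := by
  obtain ⟨E, hfd, h⟩ := Clozel1990_cArithmetic.rank_one K hcpt π hπ
  haveI := hfd
  exact finiteDimensional_ratField_of_heckeEigenvalue_mem π.1 h

/-! ### Clause (ii) of Thm. 3.13 for `GL₁`, finite part: the `Aut(ℂ)`-conjugates of an arbitrary datum -/

/-- **`π_{^σχ}` is the `σ`-conjugate at almost all places of ANY automorphic representation `π` of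
`GL₁(𝔸_K)` with Hecke character `χ`** (of infinity type `(p, q)`): `IsAutConjugate σ π π_{^σχ}`,
where `π_{^σχ} = ℂ·(^σχ ∘ det)/⊥`. This is `isAutConjugate_glOne_autConj` of
`ClozelAlgebraicityGLOneProofs` with the hypothesis "`π = ℂ·(χ∘det)/⊥`" relaxed to "`χ` is the
Hecke character of `π`" (`r(g) φ - χ(det g) φ ∈ W'`): at almost every `w` the Satake parameter of
`π` is `{χ(⟨ϖ⟩_w)}` for every uniformizer (`eventually_hasSatakeParamAt_glOne`), that of
`π_{^σχ}` is `{(^σχ)(⟨ϖ_w⟩)} = {σ(χ(ϖ_w))}`. Clozel 1990, Thm. 3.13 (ii) for `n = 1`; Weil 1956, §1.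
[cite: Clozel1990, Thm. 3.13 (ii) (n = 1)] [cite: Weil1956, §1] -/
theorem AutomorphicRepData.isAutConjugate_glOne_autConj_of_heckeCharacter
    {hcpt : isCompact_glFiniteIntegralLevel 1 K}
    (π : AutomorphicRepData (AutomorphyDatum.gl 1 K hcpt)) {χ : HeckeCharacter K}
    (hχ : ∀ (g : (AdelicGroupData.gl 1 K).Adelic), ∀ φ ∈ π.W,
      rightTranslation (AdelicGroupData.gl 1 K) g φ -
        ((χ (Matrix.GeneralLinearGroup.det g) : ℂˣ) : ℂ) • φ ∈ π.W')
    {p q : InfinitePlace K → ℤ} (h : χ.HasInfinityType p q) (σ : ℂ ≃ₐ[ℚ] ℂ)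
    {π' : AutomorphicRepData (AutomorphyDatum.gl 1 K hcpt)}
    (hW₂ : π'.W = Submodule.span ℂ
      {fun g : (AdelicGroupData.gl 1 K).Adelic ↦ (detTwist 1 (h.autConj σ) g : ℂ)})
    (hW₂' : π'.W' = ⊥) :
    IsAutConjugate σ π π' := by
  obtain ⟨𝔪', h𝔪', hχ𝔪'⟩ := (h.autConj σ).exists_level_glOne
  have hfin : {w : HeightOneSpectrum (𝓞 K) | w.asIdeal ∣ 𝔪'}.Finite := Ideal.finite_factors h𝔪'
  change ∀ᶠ w : HeightOneSpectrum (𝓞 K) in Filter.cofinite, _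
  filter_upwards [π.eventually_hasSatakeParamAt_glOne hχ, hfin.compl_mem_cofinite] with w hw hw'
  simp only [Set.mem_compl_iff, Set.mem_setOf_eq] at hw'
  have hϖv := HeckeCharacter.valued_uniformizer (K := K) w
  refine ⟨_, _, hw _ hϖv,
    AutomorphicRepData.hasSatakeParamAt_detTwist_glOne hcpt hW₂ hW₂' h𝔪' hχ𝔪' w hw' hϖv,
    fun i hi ↦ ?_⟩
  rw [h.autConj_apply_of_fst_eq_one σ (localUnits_fst w _)]
  exact heckeEigenvalueOf_one_singleton_map σ w _ hi

/-- **Clause (ii) of Clozel's Thm. 3.13 for `GL₁`, finite part, proved: every cuspidal regular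
algebraic `π` on `GL₁(𝔸_K)` has, for every `σ ∈ Aut(ℂ)`, a CUSPIDAL `σ`-conjugate at almost all
places** — namely `π_{^σχ_π}` for the (algebraic) Hecke character `χ_π` of `π`
(`exists_heckeCharacter_glOne`, `isAlgebraic_heckeCharacter_glOne_of_isCAlgebraic`,
`HeckeCharacter.isAlgebraic_iff_exists_hasInfinityType`, `exists_automorphicRepData_detTwist_glOne`;
every automorphic representation of `GL₁` is cuspidal, `AutomorphicRepData.W_le_cuspFormsGL_one`).
The archimedean half of (ii) (the infinity type of the conjugate is `^σT`) is not asserted here.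
Clozel 1990, Thm. 3.13 (ii) for `n = 1`; Weil 1956, §1. [cite: Clozel1990, Thm. 3.13 (ii) (n = 1)] -/
theorem CuspidalAutomorphicRepData.exists_cuspidal_isAutConjugate_rank_one
    {hcpt : isCompact_glFiniteIntegralLevel 1 K} (π : CuspidalAutomorphicRepData 1 K hcpt)
    (hπ : π.1.IsRegularAlgebraic) (σ : ℂ ≃ₐ[ℚ] ℂ) :
    ∃ π' : CuspidalAutomorphicRepData 1 K hcpt, IsAutConjugate σ π.1 π'.1 := by
  obtain ⟨χ, hχ⟩ := π.1.exists_heckeCharacter_glOne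
  have halg : χ.IsAlgebraic :=
    π.1.isAlgebraic_heckeCharacter_glOne_of_isCAlgebraic hχ hπ.isCAlgebraic
  obtain ⟨p, q, h⟩ := (HeckeCharacter.isAlgebraic_iff_exists_hasInfinityType χ).mp halg
  obtain ⟨π', hW₂, hW₂'⟩ := exists_automorphicRepData_detTwist_glOne hcpt (h.autConj σ)
  exact ⟨⟨π', π'.W_le_cuspFormsGL_one⟩,
    π.1.isAutConjugate_glOne_autConj_of_heckeCharacter hχ h σ hW₂ hW₂'⟩

end Literature.NumberTheory.Automorphic
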